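import Summits.ValiantsHypothesis.ValiantsHypothesis.Theorems.KPlusLogSqLawTropicalBMarkedEdgeFourBitDominant

/-!
# Route «KPlusLogSqLaw», crux `TropicalB` (stmt-ValiantsHypothesis-19771) — MARKED-EDGE sector, FOUR-BIT LAW, part 9:
# NO FULL `K`-BIT MARKED-EDGE COUNTER FOR ANY `K ≥ 4`, ON ANY NUMBER OF NODES

HONEST FRAMING.  Helper file (cell `pub-symmetroid`, seat val-sym-trop-p4 (g16), 2026-08-28; `--supports stmt-ValiantsHypothesis-19771
--as helper`).  Kernel version of THEOREM-FOURBIT.md Corollary 2 (g15): the general-`K` marked-edge sector of the lineage (g14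
MARKED-EDGE-g14.md §1: format `(m, K+1)`, exponents `d = (0, 1, 2, 4, …, 2^(K−1))`, class `l + 1` only on the diagonal cell `(l, l)` for
`l < K` — the `K` MARKED LOOPS — and class `0` only on every other cell; ANY support, ANY valuations, EVERY `m ≥ K`) admits NO FULL `K`-BIT
COUNTER (all `2^K` patterns of used marked loops realised by dominant terms) as soon as `K ≥ 4`: the patterns `7, 9, 10, 12` (context: all
higher bits OFF) would contradict `four_bit_law_static`.  So `m_min(K) = ∞` for every `K ≥ 4` (with `m_min(2) = 3`, `m_min(3) = 5` of
p619172 / p629712).  A structure theorem of ONE sector; nothing here concerns general designs, `TropicalB` in its window, `WeakLifting`, the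
doors, `MatrixDescartes` (stmt-ValiantsHypothesis-18050) or VP ≠ VNP — in particular it does NOT bound PARTIAL counters (how many of the
`2^K` patterns can be realised), which is the sector's remaining question.
-/

set_option linter.dupNamespace false
set_option autoImplicit false

namespace Summit.ValiantsHypothesis.ValiantsHypothesis.Theorems.KPlusLogSqLaw
namespace MarkedEdge
namespace FourBit

open Finset
open Summit.ValiantsHypothesis.ValiantsHypothesis.Theorems.MatrixDescartes.Negative

/-- **No full `K`-bit marked-edge counter, `K ≥ 4`, any number of nodes.**  In the `K`-bit marked-edge sector of format `(m, K+1)`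
(`d l = 0` for `l = 0` and `2^(l−1)` otherwise; a present class on cell `(i, j)` is `i + 1` if `i = j < K`, else `0`; any support and
valuations, every `m ≥ K ≥ 4`) it is impossible that every pattern `x < 2^K` is realised by a term dominant at some integer slope
(«uses marked loop `n < K` iff bit `n` of `x` is set»).  [this seat's theorem; kernel version of THEOREM-FOURBIT.md Cor. 2] -/
theorem markedEdge_no_full_counter (m K : ℕ) (hK : 4 ≤ K) (hm : K ≤ m) (d : Fin (K + 1) → ℕ)
    (hd : ∀ l : Fin (K + 1), d l = if (l : ℕ) = 0 then 0 else 2 ^ ((l : ℕ) - 1)) (v ε : Fin m → Fin m → Fin (K + 1) → ℤ)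
    (hsec : ∀ (i j : Fin m) (l : Fin (K + 1)), ε i j l ≠ 0 → (l : ℕ) = if i = j ∧ (i : ℕ) < K then (i : ℕ) + 1 else 0) :
    ¬ ∀ x : ℕ, x < 2 ^ K → ∃ (θ : ℤ) (p : Equiv.Perm (Fin m) × (Fin m → Fin (K + 1))), IsDominant d v ε θ p ∧
      ∀ n : Fin m, (n : ℕ) < K → (p.1 n = n ↔ Nat.testBit x (n : ℕ) = true) := by
  intro hfull
  have h16 : 16 ≤ 2 ^ K := by
    calc (16 : ℕ) = 2 ^ 4 := by norm_num
      _ ≤ 2 ^ K := Nat.pow_le_pow_right (by norm_num) hK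
  obtain ⟨θD, pD, dD, bD⟩ := hfull 7 (by omega)
  obtain ⟨θA, pA, dA, bA⟩ := hfull 9 (by omega)
  obtain ⟨θB, pB, dB, bB⟩ := hfull 10 (by omega)
  obtain ⟨θC, pC, dC, bC⟩ := hfull 12 (by omega)
  -- the class of a cell
  let cl : Fin m → Fin m → Fin (K + 1) := fun i j => if h : i = j ∧ (i : ℕ) < K then ⟨(i : ℕ) + 1, by omega⟩ else 0
  have hclval : ∀ i j : Fin m, ((cl i j : Fin (K + 1)) : ℕ) = if i = j ∧ (i : ℕ) < K then (i : ℕ) + 1 else 0 := by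
    intro i j
    by_cases h : i = j ∧ (i : ℕ) < K
    · simp only [cl, dif_pos h, if_pos h]
    · simp only [cl, dif_neg h, if_neg h, Fin.val_zero]
  have hstatic : ∀ i j l, ε i j l ≠ 0 → l = cl i j := fun i j l h => Fin.ext (by rw [hsec i j l h, hclval])
  have hoffd : ∀ i j : Fin m, i ≠ j → ε i j (cl i j) ≠ 0 → d (cl i j) = 0 := by
    intro i j hij _
    have : cl i j = 0 := dif_neg (show ¬ (i = j ∧ (i : ℕ) < K) from fun h => hij h.1)
    rw [this, hd]; rfl
  have hdiag : ∀ (i : Fin m), (i : ℕ) < K → d (cl i i) = 2 ^ (i : ℕ) := by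
    intro i hi
    have : cl i i = ⟨(i : ℕ) + 1, by omega⟩ := by simp only [cl, dif_pos (And.intro rfl hi)]
    rw [this, hd]
    simp
  -- the four low marked nodes
  let n₀ : Fin m := ⟨0, by omega⟩
  let n₁ : Fin m := ⟨1, by omega⟩
  let n₂ : Fin m := ⟨2, by omega⟩
  let n₃ : Fin m := ⟨3, by omega⟩
  have e0 : d (cl n₀ n₀) = 1 := by rw [hdiag n₀ (by simp [n₀]; omega)]; rfl
  have e1 : d (cl n₁ n₁) = 2 := by rw [hdiag n₁ (by simp [n₁]; omega)]; rfl
  have e2 : d (cl n₂ n₂) = 4 := by rw [hdiag n₂ (by simp [n₂]; omega)]; rfl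
  have e3 : d (cl n₃ n₃) = 8 := by rw [hdiag n₃ (by simp [n₃]; omega)]; rfl
  -- bits of 7, 9, 10, 12
  have bits : ∀ n : ℕ, (Nat.testBit 7 n = true ↔ n < 3) ∧ (Nat.testBit 9 n = true ↔ (n = 0 ∨ n = 3)) ∧
      (Nat.testBit 10 n = true ↔ (n = 1 ∨ n = 3)) ∧ (Nat.testBit 12 n = true ↔ (n = 2 ∨ n = 3)) := by
    intro n
    by_cases hn : n < 4
    · interval_cases n <;> decide
    · push Not at hn
      have h7 : Nat.testBit 7 n = false := Nat.testBit_lt_two_pow (by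
        calc (7 : ℕ) < 2 ^ 4 := by norm_num
          _ ≤ 2 ^ n := Nat.pow_le_pow_right (by norm_num) hn)
      have h9 : Nat.testBit 9 n = false := Nat.testBit_lt_two_pow (by
        calc (9 : ℕ) < 2 ^ 4 := by norm_num
          _ ≤ 2 ^ n := Nat.pow_le_pow_right (by norm_num) hn)
      have h10 : Nat.testBit 10 n = false := Nat.testBit_lt_two_pow (by
        calc (10 : ℕ) < 2 ^ 4 := by norm_num
          _ ≤ 2 ^ n := Nat.pow_le_pow_right (by norm_num) hn)
      have h12 : Nat.testBit 12 n = false := Nat.testBit_lt_two_pow (by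
        calc (12 : ℕ) < 2 ^ 4 := by norm_num
          _ ≤ 2 ^ n := Nat.pow_le_pow_right (by norm_num) hn)
      rw [h7, h9, h10, h12]
      simp only [Bool.false_eq_true, false_iff, not_lt, not_or]
      omega
  -- patterns at the four low nodes
  have pat : ∀ (q : Equiv.Perm (Fin m) × (Fin m → Fin (K + 1))) (x : ℕ),
      (∀ n : Fin m, (n : ℕ) < K → (q.1 n = n ↔ Nat.testBit x (n : ℕ) = true)) →
      (q.1 n₀ = n₀ ↔ Nat.testBit x 0 = true) ∧ (q.1 n₁ = n₁ ↔ Nat.testBit x 1 = true) ∧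
      (q.1 n₂ = n₂ ↔ Nat.testBit x 2 = true) ∧ (q.1 n₃ = n₃ ↔ Nat.testBit x 3 = true) := by
    intro q x h
    exact ⟨h n₀ (by simp [n₀]; omega), h n₁ (by simp [n₁]; omega), h n₂ (by simp [n₂]; omega), h n₃ (by simp [n₃]; omega)⟩
  obtain ⟨qD0, qD1, qD2, qD3⟩ := pat pD 7 bD
  obtain ⟨qA0, qA1, qA2, qA3⟩ := pat pA 9 bA
  obtain ⟨qB0, qB1, qB2, qB3⟩ := pat pB 10 bB
  obtain ⟨qC0, qC1, qC2, qC3⟩ := pat pC 12 bC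
  refine four_bit_law_static d v ε cl hstatic hoffd (b₀ := n₀) (b₁ := n₁) (b₂ := n₂) (b₃ := n₃)
    (by rw [e0, e1]; norm_num) (by rw [e1, e2]; norm_num) (by rw [e1, e2, e3]; norm_num) dD dA dB dC
    (qD0.mpr ((bits 0).1.mpr (by norm_num))) (qD1.mpr ((bits 1).1.mpr (by norm_num))) (qD2.mpr ((bits 2).1.mpr (by norm_num)))
    (fun h => absurd ((bits 3).1.mp (qD3.mp h)) (by norm_num))
    (qA0.mpr ((bits 0).2.1.mpr (Or.inl rfl))) (fun h => absurd ((bits 1).2.1.mp (qA1.mp h)) (by norm_num))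
    (fun h => absurd ((bits 2).2.1.mp (qA2.mp h)) (by norm_num)) (qA3.mpr ((bits 3).2.1.mpr (Or.inr rfl)))
    (fun h => absurd ((bits 0).2.2.1.mp (qB0.mp h)) (by norm_num)) (qB1.mpr ((bits 1).2.2.1.mpr (Or.inl rfl)))
    (fun h => absurd ((bits 2).2.2.1.mp (qB2.mp h)) (by norm_num)) (qB3.mpr ((bits 3).2.2.1.mpr (Or.inr rfl)))
    (fun h => absurd ((bits 0).2.2.2.mp (qC0.mp h)) (by norm_num)) (fun h => absurd ((bits 1).2.2.2.mp (qC1.mp h)) (by norm_num))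
    (qC2.mpr ((bits 2).2.2.2.mpr (Or.inl rfl))) (qC3.mpr ((bits 3).2.2.2.mpr (Or.inr rfl))) ?_
  -- context: the higher marked loops are OFF in all four patterns, every other diagonal cell has exponent 0
  intro i h0 h1 h2 h3 hdi
  have hiK : (i : ℕ) < K := by
    by_contra hge
    apply hdi
    have : cl i i = 0 := dif_neg (show ¬ (i = i ∧ (i : ℕ) < K) from fun h => hge h.2)
    rw [this, hd]; rfl
  have hi4 : 4 ≤ (i : ℕ) := by
    by_contra hlt
    push Not at hlt
    have : (i : ℕ) = 0 ∨ (i : ℕ) = 1 ∨ (i : ℕ) = 2 ∨ (i : ℕ) = 3 := by omega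
    rcases this with h | h | h | h
    · exact h0 (Fin.ext h)
    · exact h1 (Fin.ext h)
    · exact h2 (Fin.ext h)
    · exact h3 (Fin.ext h)
  have offD : pD.1 i ≠ i := fun h => by
    have := (bits (i : ℕ)).1.mp ((bD i hiK).mp h); omega
  have offA : pA.1 i ≠ i := fun h => by
    have := (bits (i : ℕ)).2.1.mp ((bA i hiK).mp h); omega
  have offB : pB.1 i ≠ i := fun h => by
    have := (bits (i : ℕ)).2.2.1.mp ((bB i hiK).mp h); omega
  have offC : pC.1 i ≠ i := fun h => by
    have := (bits (i : ℕ)).2.2.2.mp ((bC i hiK).mp h); omega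
  exact ⟨⟨fun h => absurd h offA, fun h => absurd h offD⟩, ⟨fun h => absurd h offB, fun h => absurd h offD⟩,
    ⟨fun h => absurd h offC, fun h => absurd h offD⟩⟩

end FourBit
end MarkedEdge
end Summit.ValiantsHypothesis.ValiantsHypothesis.Theorems.KPlusLogSqLaw
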